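import Literature.NumberTheory.LFunctions.Zhang2022.Section12LogFreeMidSum
import Literature.NumberTheory.LFunctions.Zhang2022.RepairGapSection12LogFreeCorePremise
import Literature.NumberTheory.LFunctions.Zhang2022.RepairGapLemma83RelFree
import Literature.NumberTheory.LFunctions.Zhang2022.RepairGapLemma57Premise
import Literature.NumberTheory.LFunctions.Zhang2022.RepairGapExceptionalZeroPremise
import HarnessLib

/-!
# Zhang (2022), rescue GAP/BED (D-0124 (3)(4)): §12 — the log-free bound of the mid-range `l`-sum (`Lemma84.logfree_mid_bound`,
# the (A)-input of the node `Mid1225`) under the minimum premise `‖L(1,χ)‖ ≤ 𝓛⁻¹⁵`, UNCONDITIONAL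

Topic `Literature/NumberTheory/LFunctions/Zhang2022` (Landau–Siegel audit tree; verdict-neutral).
Y. Zhang, *Discrete mean estimates and the Landau–Siegel zero*, arXiv:2211.02515v1 (2022)
[Zhang2022LandauSiegel] — **an unrefereed manuscript under adjudication; nothing in this file asserts or
denies its Theorems 1–2, and nothing here is a claim about Landau–Siegel zeros. The programme SEARCHES and
TYPES; no claim about Landau–Siegel zeros, Theorems 1–2 of arXiv:2211.02515 or a repaired Margin232 until a
kernel theorem says so.**

`Lemma84.logfree_mid_bound` (file `Section12LogFreeMidSum`: on `P″₁/T < dr ≤ P″₁`,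
`‖Σ_{l<P″₂/dr} χ(l)ξ₀ⱼ(l;d,r)l^{β₆−1}‖ ≤ C𝓛⁻⁴(dr/φ(dr))⁴` — the hypothesis `hLF` of `Typed.Sec12C.mid1225_of_logfree`) is
Zhang's Lemma 8.4 contour argument in log-free form; it consumes Assumption (A) through the same four doors as the Lemma 8.4 edge:
Lemma 8.3 (rel) [now hypothesis-free, `Repair.Gap.lemma83Rel_free`], the exceptional-zero package [`exceptional_package_pow15`,
uses `1 − ρ̃ ≤ K/𝓛²`, `K/𝓛¹⁰` only], Lemma 5.7 [`lemma57_of_norm_le`], and the log-free core [`Lemma84.logfree_core_pow15`,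
`RepairGapSection12LogFreeCorePremise`]. This file re-runs it VERBATIM with those substitutions (the same edit as p593006 /
p608820): **`logfree_mid_bound_pow15`** — same constant `Cbook + 4Cw`, same thresholds plus `𝓛 ≥ 1/c₅₇`, `𝓛 ≥ 1`, guard
`‖L(1,χ)‖ ≤ 𝓛⁻¹⁵`, every `c′`. Next (not in this file): `sum122_mid_bound_of_logfree` [5.7 door] and `mid1225_of_sum122_bound`
[8.2 leaf] give the node `Mid1225` at 15. Theorems only; no definition, no named fact; nothing about (A) itself.

## References

* Y. Zhang, arXiv:2211.02515v1 (2022), §12 (12.11)/(12.12) pp. 70–71; §8 Lemma 8.4 (proof); §5 Lemmas 5.5, 5.7, 5.8.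
  [cite: Zhang2022LandauSiegel, §12 (12.12) p.71] [cite: MontgomeryVaughan2007, §6.2, Thm 11.4]
-/

noncomputable section

open Complex Real Finset

namespace Literature.NumberTheory.LFunctions.Zhang2022.Lemma84

open Skeleton XiZeroMajorant

/-- A threshold `D₁` beyond which `log D ≥ M`. [folklore] -/
private theorem exists_nat_le_log₇ (M : ℝ) : ∃ D₀ : ℕ, ∀ D : ℕ, D₀ ≤ D → M ≤ Real.log D := by
  refine ⟨⌈Real.exp M⌉₊ + 1, fun D hD => ?_⟩
  have h1 : Real.exp M ≤ D := by
    have : (⌈Real.exp M⌉₊ : ℝ) + 1 ≤ D := by exact_mod_cast hD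
    linarith [Nat.le_ceil (Real.exp M)]
  have hD0 : (0 : ℝ) < D := lt_of_lt_of_le (Real.exp_pos M) h1
  rw [Real.le_log_iff_exp_le hD0]
  exact h1

/-- `∏_{q∣n}(1 − q⁻¹)⁻¹ = n/φ(n)` for `n ≥ 1`. [folklore] -/
private theorem prodInv_eq_self_div_totient₇ {n : ℕ} (hn : n ≠ 0) :
    ∏ q ∈ n.primeFactors, (1 - (q : ℝ)⁻¹)⁻¹ = (n : ℝ) / Nat.totient n := by
  rw [self_div_totient_eq_prod hn]
  refine Finset.prod_congr rfl fun q hq => ?_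
  have hq : (1 : ℝ) < q := by exact_mod_cast (Nat.prime_of_mem_primeFactors hq).one_lt
  have hq0 : (q : ℝ) ≠ 0 := by linarith
  have hq1 : (q : ℝ) - 1 ≠ 0 := by linarith
  field_simp

set_option maxHeartbeats 1600000 in
/-- **The log-free mid-range bound under the minimum premise `‖L(1,χ)‖ ≤ 𝓛⁻¹⁵`, UNCONDITIONAL** (twin of
`Lemma84.logfree_mid_bound`, same constant; Lemma 8.3 hypothesis-free, exceptional zero / Lemma 5.7 / log-free core through their
`𝓛⁻¹⁵` doors). [cite: Zhang2022LandauSiegel, §12 (12.12) p.71; §8 Lemma 8.4 (proof)] [cite: MontgomeryVaughan2007, §6.2, Thm 11.4] -/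
theorem logfree_mid_bound_pow15 (c' : ℝ) :
    ∃ C : ℝ, ForAllLarge fun D _ χ => ‖χ.LFunction 1‖ ≤ 1 / Real.log D ^ 15 →
      ∀ j ∈ ({1, 2, 3} : Finset ℕ), ∀ d r : ℕ, 1 ≤ d → 1 ≤ r →
        P1pp D / bigT D < ((d * r : ℕ) : ℝ) → ((d * r : ℕ) : ℝ) ≤ P1pp D →
          ‖∑ l ∈ Finset.Ico 1 ⌈P2pp D / ((d * r : ℕ) : ℝ)⌉₊,
              χ (l : ZMod D) * xiZero c' D j l d r / (l : ℂ) ^ (1 - beta6 D)‖ ≤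
            C * (ell D ^ 4)⁻¹ * ((((d * r : ℕ) : ℝ)) / Nat.totient (d * r)) ^ 4 := by
  obtain ⟨C₈₃, D83, h83⟩ := Repair.Gap.lemma83Rel_free c'
  obtain ⟨c, hc, hc4, Cinv, hCinv, K, hK, D₁, hpack⟩ := Repair.Gap.exceptional_package_pow15
  obtain ⟨L₅₇, c57, hc57, h57⟩ := Repair.Gap.lemma57_of_norm_le
  obtain ⟨Cw, x₀, hCw0, hx₀, hwin⟩ := window_xiZero_le
  -- constants
  set C : ℝ := |C₈₃| with hCdef
  have hC0 : 0 ≤ C := abs_nonneg _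
  set K₈ : ℝ := 7 + 15 * |c'| with hK₈
  have hK₈1 : 1 ≤ K₈ := by rw [hK₈]; linarith [abs_nonneg c']
  set C₅ : ℝ := 1 + 16 * Real.exp (9 / 2) * π ^ 2 * K₈ ^ 2 with hC₅
  set ℓ₀ : ℝ := Real.exp (-1) / 4 with hℓ₀
  have hℓ₀0 : 0 < ℓ₀ := by positivity
  set m : ℕ := ⌈2 * C⌉₊ with hm
  set A₁ : ℝ := C * (Real.exp (8 * C + 4 * C * ((Nat.factorial 9 : ℝ) / 2 ^ 9)) * 2 ^ m) with hA₁
  have hA₁0 : 0 ≤ A₁ := by positivity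
  set Cbook : ℝ := 1 / (2 * π) * (4 * Real.exp π * A₁ * (m + 81).factorial +
      81600 * π * Real.exp (1 / 96) * A₁ * Cinv / c ^ 2 *
        ((m + 59).factorial / (c / 2000) ^ (m + 59)) +
      3600 * Real.exp π * A₁ * Cinv * ((m + 57).factorial / 2 ^ (m + 57)) +
      672 * Real.exp π * ((1 + 16 * Real.exp (9 / 2) * π ^ 2 * K₈ ^ 2) * (24 * K₈ ^ 2 + 2 * K₈) +
        128 * π * Real.exp (9 / 2) * K₈ ^ 3 * C + 8 * π * Real.exp (9 / 2) * K₈ ^ 2))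
    with hCbook
  -- the threshold
  set Lmax : ℝ := max (max (max 4 L₅₇) (max (8 * π / c) (16 * K / c)))
    (max (max (K + 1) (K₈ * π)) (max (4 * C₅ / (ℓ₀ * π)) x₀)) with hLmax
  obtain ⟨D₂, hD₂⟩ := exists_nat_le_log₇ (max Lmax (max 1 (1 / c57)))
  refine ⟨Cbook + 4 * Cw, max (max D83 D₁) D₂,
    fun D _ χ hD hq hp h15 j hj d r hd hr hlo hhi => ?_⟩
  have hD83 : D83 ≤ D := le_trans (le_trans (le_max_left _ _) (le_max_left _ _)) hD
  have hD₁ : D₁ ≤ D := le_trans (le_trans (le_max_right _ _) (le_max_left _ _)) hD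
  have hLm0 := hD₂ D (le_trans (le_max_right _ _) hD)
  have hLm : Lmax ≤ Real.log D := le_trans (le_max_left _ _) hLm0
  have hLc57 : 1 / c57 ≤ Real.log D := le_trans (le_trans (le_max_right _ _) (le_max_right _ _)) hLm0
  set 𝓛 : ℝ := Real.log D with h𝓛def
  have h𝓛4 : 4 ≤ 𝓛 := le_trans (by simp [hLmax]) hLm
  have h𝓛3 : 3 ≤ 𝓛 := by linarith
  have hL57 : L₅₇ ≤ 𝓛 := le_trans (by simp [hLmax]) hLm
  have hL8πc : 8 * π / c ≤ 𝓛 := le_trans (by simp [hLmax]) hLm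
  have hL16K : 16 * K / c ≤ 𝓛 := le_trans (by simp [hLmax]) hLm
  have hLK1 : K + 1 ≤ 𝓛 := le_trans (by simp [hLmax]) hLm
  have hLK₈ : K₈ * π ≤ 𝓛 := le_trans (by simp [hLmax]) hLm
  have hLC₅ : 4 * C₅ / (ℓ₀ * π) ≤ 𝓛 := le_trans (by simp [hLmax]) hLm
  have hLx₀ : x₀ ≤ 𝓛 := le_trans (by simp [hLmax]) hLm
  have h𝓛0 : 0 < 𝓛 := by linarith
  have h𝓛1 : 1 ≤ 𝓛 := by linarith
  -- the Lemma 5.7 door: `𝓛⁻¹⁵ ≤ c₅₇/𝓛` since `𝓛¹⁴ ≥ 𝓛 ≥ 1/c₅₇`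
  have hc57L : ‖χ.LFunction 1‖ ≤ c57 / Real.log D := by
    refine h15.trans ?_
    rw [← h𝓛def, div_le_div_iff₀ (pow_pos h𝓛0 _) h𝓛0]
    have h14 : 𝓛 ≤ 𝓛 ^ 14 := le_self_pow₀ h𝓛1 (by norm_num)
    have h1c : 1 ≤ c57 * 𝓛 ^ 14 := by
      have h := mul_le_mul_of_nonneg_left (hLc57.trans h14) hc57.le
      rwa [mul_one_div_cancel hc57.ne'] at h
    calc 1 * 𝓛 = 𝓛 := one_mul _
      _ ≤ (c57 * 𝓛 ^ 14) * 𝓛 := le_mul_of_one_le_left h𝓛0.le h1c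
      _ = c57 * 𝓛 ^ 15 := by ring
  have hℓ : ell D = 𝓛 := rfl
  have hπ0 := Real.pi_pos
  have hπ3 := Real.pi_gt_three
  -- `D` itself
  have hD0 : (0 : ℝ) < D := by
    rcases lt_or_ge 0 (D : ℝ) with h | h
    · exact h
    · have : Real.log (D : ℝ) ≤ 0 := by
        have : (D : ℝ) = 0 := le_antisymm h (Nat.cast_nonneg D)
        rw [this, Real.log_zero]
      linarith
  have hDexp : (D : ℝ) = Real.exp 𝓛 := by rw [h𝓛def, Real.exp_log hD0]
  have hD3 : (3 : ℝ) ≤ D := by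
    have : Real.exp 3 ≤ Real.exp 𝓛 := Real.exp_le_exp.2 h𝓛3
    have h3 : (3 : ℝ) ≤ Real.exp 3 := by have := Real.add_one_le_exp (3 : ℝ); linarith
    linarith
  have hD2 : 2 ≤ D := by exact_mod_cast (show (2 : ℝ) ≤ D by linarith)
  have hχ1 : χ ≠ 1 := Lemma31.ne_one_of_isPrimitive χ hD2 hp
  -- parameters
  set α : ℝ := alpha D with hαdef
  have hαeq : α = π / 𝓛 ^ 9 := alpha_eq D
  have hα0 : 0 < α := by rw [hαeq]; positivity
  set η : ℝ := c / (8 * 𝓛) with hηdef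
  have hη0 : 0 < η := by positivity
  have hη' : η ≤ 1 / 96 := by
    calc η = c / (8 * 𝓛) := hηdef
      _ ≤ (1 / 4) / (8 * 3) := by gcongr
      _ = 1 / 96 := by norm_num
  have hαη : α ≤ η := by
    rw [hαeq, hηdef, div_le_div_iff₀ (by positivity) (by positivity)]
    have h8 : 𝓛 ≤ 𝓛 ^ 8 := le_self_pow₀ h𝓛1 (by norm_num)
    have h1 : 8 * π ≤ c * 𝓛 := by rw [div_le_iff₀ hc] at hL8πc; linarith
    calc π * (8 * 𝓛) = (8 * π) * 𝓛 := by ring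
      _ ≤ (c * 𝓛) * 𝓛 ^ 8 := by gcongr
      _ = c * 𝓛 ^ 9 := by ring
  have hη40 : η ≤ 1 / 40 := by linarith
  -- the exceptional zero and the zero-free package
  obtain ⟨ρ, hρ1, hρK, hLρ, hL'ρ, hzfp⟩ := hpack D χ hD₁ hχ1 h15
  have hρη : 1 - η / 2 ≤ ρ := by
    have h0 : 1 - ρ ≤ K / 𝓛 ^ 2 := by
      refine hρK.trans ?_
      rw [← div_eq_mul_inv]
      exact div_le_div_of_nonneg_left hK.le (by positivity) (pow_le_pow_right₀ h𝓛1 (by norm_num))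
    have h1 : K / 𝓛 ^ 2 ≤ c / (16 * 𝓛) := by
      rw [div_le_div_iff₀ (by positivity) (by positivity)]
      have h16 : 16 * K ≤ c * 𝓛 := by rw [div_le_iff₀ hc] at hL16K; linarith
      calc K * (16 * 𝓛) = (16 * K) * 𝓛 := by ring
        _ ≤ (c * 𝓛) * 𝓛 := by gcongr
        _ = c * 𝓛 ^ 2 := by ring
    rw [hηdef]
    have : c / (8 * 𝓛) / 2 = c / (16 * 𝓛) := by ring
    linarith
  have hρα : 1 - α / 2 < ρ := by
    have h1 : 1 - ρ ≤ K / 𝓛 ^ 10 := by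
      refine hρK.trans ?_
      rw [← div_eq_mul_inv]
      exact div_le_div_of_nonneg_left hK.le (by positivity) (pow_le_pow_right₀ h𝓛1 (by norm_num))
    have h2 : K / 𝓛 ^ 10 < π / 𝓛 ^ 9 / 2 := by
      rw [div_div, div_lt_div_iff₀ (by positivity) (by positivity)]
      have h3 : K * 2 < π * 𝓛 := by
        calc K * 2 < 3 * (K + 1) := by linarith
          _ ≤ π * 𝓛 := mul_le_mul hπ3.le hLK1 (by linarith) (by linarith)
      calc K * (𝓛 ^ 9 * 2) = (K * 2) * 𝓛 ^ 9 := by ring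
        _ < (π * 𝓛) * 𝓛 ^ 9 := by gcongr
        _ = π * 𝓛 ^ 10 := by ring
    rw [hαeq]; linarith
  -- the `1/L` package on `Re s ≥ 1 − 2η`, `|Im s| ≤ D + 1`
  have hlog5 : Real.log ((D : ℝ) + 5) ≤ 2 * 𝓛 := by
    have h1 : (D : ℝ) + 5 ≤ (D : ℝ) ^ 2 := by
      have h0 : (0 : ℝ) ≤ ((D : ℝ) - 3) * ((D : ℝ) + 2) := mul_nonneg (by linarith) (by linarith)
      have e : ((D : ℝ) - 3) * ((D : ℝ) + 2) = (D : ℝ) ^ 2 - (D : ℝ) - 6 := by ring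
      rw [e] at h0; linarith
    calc Real.log ((D : ℝ) + 5) ≤ Real.log ((D : ℝ) ^ 2) := Real.log_le_log (by positivity) h1
      _ = 2 * 𝓛 := by rw [Real.log_pow, h𝓛def]; ring
  have hpk : ∀ s : ℂ, 1 - 2 * η ≤ s.re → |s.im| ≤ (D : ℝ) + 1 → s ≠ (ρ : ℂ) →
      χ.LFunction s ≠ 0 ∧ ‖(χ.LFunction s)⁻¹‖ ≤ 3 * Cinv * 𝓛 * (1 + ‖s - ρ‖⁻¹) := by
    intro s hs him hne
    have hls : Real.log (|s.im| + 4) ≤ 2 * 𝓛 :=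
      (Real.log_le_log (by positivity) (by linarith)).trans hlog5
    have hl0 : 0 ≤ Real.log (|s.im| + 4) := Real.log_nonneg (by linarith [abs_nonneg s.im])
    have hsum0 : 0 < Real.log D + Real.log (|s.im| + 4) := by rw [← h𝓛def]; linarith
    have hre : 1 - c / (Real.log D + Real.log (|s.im| + 4)) ≤ s.re := by
      have h1 : 2 * η ≤ c / (Real.log D + Real.log (|s.im| + 4)) := by
        rw [hηdef, le_div_iff₀ hsum0, ← h𝓛def]
        have : 2 * (c / (8 * 𝓛)) * (𝓛 + Real.log (|s.im| + 4)) ≤ 2 * (c / (8 * 𝓛)) * (3 * 𝓛) := by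
          gcongr; linarith
        have e : 2 * (c / (8 * 𝓛)) * (3 * 𝓛) = 3 * c / 4 := by field_simp; ring
        linarith
      linarith
    obtain ⟨hne0, hb⟩ := hzfp s hre hne
    refine ⟨hne0, hb.trans ?_⟩
    have : Cinv * (Real.log D + Real.log (|s.im| + 4)) ≤ 3 * Cinv * 𝓛 := by
      rw [← h𝓛def]
      calc Cinv * (𝓛 + Real.log (|s.im| + 4)) ≤ Cinv * (𝓛 + 2 * 𝓛) := by gcongr
        _ = 3 * Cinv * 𝓛 := by ring
    exact mul_le_mul_of_nonneg_right this (by positivity)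
  -- the continuation `U` of Lemma 8.3 (relative form)
  have hd0 : d ≠ 0 := by omega
  have hr0 : r ≠ 0 := by omega
  have hdr0 : d * r ≠ 0 := mul_ne_zero hd0 hr0
  have hdrpos : (0 : ℝ) < ((d * r : ℕ) : ℝ) := by exact_mod_cast Nat.pos_of_ne_zero hdr0
  -- sizes: `P″₁, P″₂, P, T`
  have hT1 : 1 < bigT D := by rw [bigT]; exact Real.one_lt_exp_iff.2 (by positivity)
  have hT2 : 1 ≤ bigT D ^ 2 := one_le_pow₀ hT1.le
  have hP1pp : 0 < P1pp D := Sec12D.P1pp_pos (by rw [← h𝓛def]; exact h𝓛1)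
  have hP2pp : 0 < P2pp D := Sec12D.P2pp_pos (by rw [← h𝓛def]; exact h𝓛1)
  have hbigP1 : 1 < bigP D := by rw [bigP]; exact Real.one_lt_exp_iff.2 (by positivity)
  have hP12 : P1pp D < P2pp D := by
    have e := Sec12D.P2pp_div_P1pp (D := D) (by rw [← h𝓛def]; exact h𝓛1)
    have hgt : 1 < bigP D ^ (0.004 : ℝ) := Real.one_lt_rpow hbigP1 (by norm_num)
    rw [← e, lt_div_iff₀ hP1pp] at hgt
    linarith
  have hP2le : P2pp D ≤ bigP D / bigT D ^ 2 :=
    Sec12D.P2pp_le_P_div_T_sq (by rw [← h𝓛def]; exact h𝓛3)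
  have hdrP : ((d * r : ℕ) : ℝ) < bigP D / bigT D ^ 2 :=
    lt_of_le_of_lt hhi (lt_of_lt_of_le hP12 hP2le)
  obtain ⟨U, hUd, hU1, hU2, hU3⟩ := h83 D χ hD83 hq hp j hj d r hd hr hdrP
  -- `U` on `Re w ≥ 1 − η`
  set MU : ℝ := C * Real.exp (2 * C * (Real.log (2 * Real.log D) + 4) +
    4 * C * Real.log D ^ 9 / (D : ℝ) ^ 2) with hMUdef
  have hMU0 : 0 ≤ MU := by positivity
  have hlogdr : Real.log ((d * r : ℕ) : ℝ) ≤ Real.log D ^ 9 := by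
    have h1 : ((d * r : ℕ) : ℝ) ≤ bigP D := hdrP.le.trans (div_le_self (bigP_pos D).le hT2)
    calc Real.log ((d * r : ℕ) : ℝ) ≤ Real.log (bigP D) := Real.log_le_log hdrpos h1
      _ = Real.log D ^ 9 := by rw [bigP, Real.log_exp, ell]
  have hU : ∀ w : ℂ, 1 - η ≤ w.re → ‖U w‖ ≤ MU := by
    intro w hw
    have hw9 : 9 / 10 < w.re := by linarith
    have h1 := hU2 w hw9
    have hηL : 2 * η * Real.log D ≤ 1 / 4 := by
      have e : 2 * (c / (8 * 𝓛)) * 𝓛 = c / 4 := by field_simp; ring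
      rw [hηdef, ← h𝓛def, e]
      linarith
    have hprod := prod_primeFactors_le (D := D) (n := d * r) (by rw [← h𝓛def]; linarith) hdr0 hlogdr
      hC0 hη0.le hηL (σ := w.re) hw
    calc ‖U w‖ ≤ C₈₃ * ∏ q ∈ (d * r).primeFactors, (1 + C₈₃ * (q : ℝ) ^ (-w.re)) := h1
      _ ≤ |C₈₃ * ∏ q ∈ (d * r).primeFactors, (1 + C₈₃ * (q : ℝ) ^ (-w.re))| := le_abs_self _
      _ = C * ∏ q ∈ (d * r).primeFactors, |1 + C₈₃ * (q : ℝ) ^ (-w.re)| := by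
          rw [abs_mul, Finset.abs_prod]
      _ ≤ C * ∏ q ∈ (d * r).primeFactors, (1 + C * (q : ℝ) ^ (-w.re)) := by
          refine mul_le_mul_of_nonneg_left ?_ hC0
          refine Finset.prod_le_prod (fun _ _ => abs_nonneg _) fun q _ => ?_
          calc |1 + C₈₃ * (q : ℝ) ^ (-w.re)| ≤ |(1 : ℝ)| + |C₈₃ * (q : ℝ) ^ (-w.re)| := abs_add_le _ _
            _ = 1 + C * (q : ℝ) ^ (-w.re) := by
                rw [abs_one, abs_mul, abs_of_nonneg (Real.rpow_nonneg (Nat.cast_nonneg q) _)]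
      _ ≤ MU := mul_le_mul_of_nonneg_left hprod hC0
  have hMUle : MU ≤ A₁ * 𝓛 ^ m := by
    have h := frakM_le (D := D) hC0 (by rw [← h𝓛def]; exact h𝓛1)
    rw [hMUdef, hA₁, h𝓛def]
    calc C * Real.exp (2 * C * (Real.log (2 * Real.log D) + 4) + 4 * C * Real.log D ^ 9 / (D : ℝ) ^ 2)
        ≤ C * (Real.exp (8 * C + 4 * C * ((Nat.factorial 9 : ℝ) / 2 ^ 9)) * 2 ^ ⌈2 * C⌉₊ *
            Real.log D ^ ⌈2 * C⌉₊) := mul_le_mul_of_nonneg_left h hC0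
      _ = _ := by rw [hm]; ring
  have hU3' : ∀ s : ℂ, ‖s - 1‖ ≤ 5 * alpha D → ‖U s - PiW χ d r‖ ≤
      C * (ell D ^ 8)⁻¹ * ∏ q ∈ (d * r).primeFactors, (1 - (q : ℝ)⁻¹)⁻¹ := by
    intro s hs
    refine (hU3 s hs).trans ?_
    have := Literature.NumberTheory.Sieve.GreenTao2008.GYCorr.one_le_prod_one_sub_inv_inv (d * r)
    gcongr
    exact le_abs_self _
  -- `L(s,χ)` on `Re s ≥ 1 − η`, `|s| ≤ D + 4`
  have hBL : ∀ s : ℂ, 1 - η ≤ s.re → ‖s‖ ≤ (D : ℝ) + 4 → ‖χ.LFunction s‖ ≤ 2 * (4 + 3 * 𝓛) := by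
    intro s hs hsn
    have hls : Real.log (‖s‖ + 1) ≤ 2 * 𝓛 :=
      (Real.log_le_log (by positivity) (by linarith)).trans hlog5
    have hl0 : 0 ≤ Real.log (‖s‖ + 1) := Real.log_nonneg (by linarith [norm_nonneg s])
    have h := norm_LFunction_le_near_one χ hχ1 (η := η) (by linarith) hs (by
      rw [← h𝓛def]
      calc η * (𝓛 + Real.log (‖s‖ + 1)) ≤ η * (𝓛 + 2 * 𝓛) := by gcongr
        _ = 3 * c / 8 := by rw [hηdef]; field_simp; ring
        _ ≤ 1 / 8 := by linarith)
    rw [← h𝓛def] at h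
    linarith
  -- `|L′(1,χ)| ≥ ℓ₀`
  have hℓ' : ℓ₀ ≤ ‖deriv χ.LFunction 1‖ := by
    have h := h57 D χ hp hq.sq_eq_one hL57 hc57L
    have hφpos : (0 : ℝ) < Nat.totient D := by exact_mod_cast Nat.totient_pos.mpr (by omega)
    have hφle : (Nat.totient D : ℝ) ≤ D := by exact_mod_cast Nat.totient_le D
    have hrat : (1 : ℝ) ≤ (D : ℝ) / Nat.totient D := by rw [le_div_iff₀ hφpos]; linarith
    calc ℓ₀ = Real.exp (-1) / 4 * 1 := (mul_one _).symm
      _ ≤ Real.exp (-1) / 4 * ((D : ℝ) / Nat.totient D) := by gcongr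
      _ ≤ (deriv χ.LFunction 1).re := h
      _ ≤ ‖deriv χ.LFunction 1‖ := Complex.re_le_norm _
  -- Lemma 5.8's range and the `E ≤ ℓ₀α/4` condition
  have hK₈L : K₈ * π ≤ Real.log D ^ 8 := hLK₈.trans (le_self_pow₀ h𝓛1 (by norm_num))
  have hE : C₅ / Real.log D ^ 15 ≤ ℓ₀ * alpha D / 4 := by
    rw [← hαdef, hαeq, ← h𝓛def]
    rw [div_le_iff₀ (by positivity)]
    have h1 : 4 * C₅ ≤ ℓ₀ * π * 𝓛 := by rw [div_le_iff₀ (by positivity)] at hLC₅; linarith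
    have h2 : 𝓛 ^ 15 = 𝓛 ^ 9 * 𝓛 ^ 6 := by ring
    have h3 : 𝓛 ≤ 𝓛 ^ 6 := le_self_pow₀ h𝓛1 (by norm_num)
    have h4 : ℓ₀ * π * 𝓛 ≤ ℓ₀ * π * 𝓛 ^ 6 := mul_le_mul_of_nonneg_left h3 (by positivity)
    calc C₅ = 4 * C₅ / 4 := by ring
      _ ≤ ℓ₀ * π * 𝓛 ^ 6 / 4 := by linarith
      _ = ℓ₀ * (π / 𝓛 ^ 9) / 4 * 𝓛 ^ 15 := by rw [h2]; field_simp
  -- the two points `Y = P″₂/dr`, `Y′ = Ye^{−h}`, `h = 𝓛⁻⁵⁰`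
  set Y : ℝ := P2pp D / ((d * r : ℕ) : ℝ) with hYdef
  have hY0 : 0 < Y := div_pos hP2pp hdrpos
  set h : ℝ := (𝓛 ^ 50)⁻¹ with hhdef
  have h50 : (2 : ℝ) ≤ 𝓛 ^ 50 := le_trans (by linarith) (le_self_pow₀ h𝓛1 (by norm_num))
  have hh0 : 0 < h := by rw [hhdef]; positivity
  have hh12 : h ≤ 1 / 2 := by
    rw [hhdef, inv_eq_one_div]
    exact div_le_div_of_nonneg_left zero_le_one (by norm_num) h50
  set Y' : ℝ := Y * Real.exp (-h) with hY'def
  have hY'0 : 0 < Y' := mul_pos hY0 (Real.exp_pos _)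
  have hlogY' : Real.log Y' = Real.log Y - h := by
    rw [hY'def, Real.log_mul hY0.ne' (Real.exp_pos _).ne', Real.log_exp]; ring
  have hY'Y : Y' < Y := by
    rw [hY'def]
    exact mul_lt_of_lt_one_right hY0 (Real.exp_lt_one_iff.2 (by linarith))
  have hYeq : Y = Y' * Real.exp h := by
    rw [hY'def, mul_assoc, ← Real.exp_add, neg_add_cancel, Real.exp_zero, mul_one]
  -- `log Y ∈ [0.004𝓛⁹, 𝓛⁹]`
  have hYlo : bigP D ^ (0.004 : ℝ) ≤ Y := by
    rw [← Sec12D.P2pp_div_P1pp (D := D) (by rw [← h𝓛def]; exact h𝓛1), hYdef]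
    exact div_le_div_of_nonneg_left hP2pp.le hdrpos hhi
  have hlogY1 : 0.004 * 𝓛 ^ 9 ≤ Real.log Y := by
    have e : Real.log (bigP D ^ (0.004 : ℝ)) = 0.004 * 𝓛 ^ 9 := by
      rw [Real.log_rpow (bigP_pos D), bigP, Real.log_exp, hℓ]
    rw [← e]
    exact Real.log_le_log (Real.rpow_pos_of_pos (bigP_pos D) _) hYlo
  have hYle : Y ≤ bigP D := by
    have h1 : Y ≤ P2pp D := by
      rw [hYdef]
      exact div_le_self hP2pp.le (by exact_mod_cast Nat.one_le_iff_ne_zero.2 hdr0)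
    exact h1.trans (hP2le.trans (div_le_self (bigP_pos D).le hT2))
  have hlogY2 : Real.log Y ≤ 𝓛 ^ 9 := by
    calc Real.log Y ≤ Real.log (bigP D) := Real.log_le_log hY0 hYle
      _ = 𝓛 ^ 9 := by rw [bigP, Real.log_exp, hℓ]
  have hlogY0 : 0 ≤ Real.log Y := le_trans (by positivity) hlogY1
  have hlogY'1 : 0.004 * 𝓛 ^ 9 - 1 ≤ Real.log Y' := by rw [hlogY']; linarith
  have h47 : (4 : ℝ) ^ 7 ≤ 𝓛 ^ 7 := pow_le_pow_left₀ (by norm_num) h𝓛4 7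
  have hsq : 0 ≤ 𝓛 ^ 2 := sq_nonneg 𝓛
  have hbig : 𝓛 ^ 2 + 200 * 𝓛 + 1 ≤ 0.004 * 𝓛 ^ 9 := by
    have e : 𝓛 ^ 9 = 𝓛 ^ 7 * 𝓛 ^ 2 := by ring
    rw [e]
    have h1 : (4 : ℝ) ^ 7 * 𝓛 ^ 2 ≤ 𝓛 ^ 7 * 𝓛 ^ 2 := mul_le_mul_of_nonneg_right h47 hsq
    have hs : 4 * 𝓛 ≤ 𝓛 ^ 2 := by nlinarith [mul_nonneg (sub_nonneg.2 h𝓛4) h𝓛0.le]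
    norm_num at h1
    linarith
  have hlogY'2 : 𝓛 ^ 2 + 200 * 𝓛 ≤ Real.log Y' := by linarith
  have hlogY'0 : 0 ≤ Real.log Y' := by linarith
  have hlogY'le : Real.log Y' ≤ 𝓛 ^ 9 := by rw [hlogY']; linarith
  have hY'exp : Real.exp (200 * 𝓛) ≤ Y' := by
    rw [← Real.exp_log hY'0]; exact Real.exp_le_exp.2 (by linarith)
  have hexp𝓛 : 𝓛 ≤ Real.exp 𝓛 := by linarith [Real.add_one_le_exp 𝓛]
  have hY'1 : 1 ≤ Y' := le_trans (Real.one_le_exp (by positivity)) hY'exp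
  have hTY' : bigT D < Y' := by
    rw [bigT, hℓ]
    have h11 : 𝓛 ^ (1.1 : ℝ) ≤ 𝓛 ^ 2 := by
      have := Real.rpow_le_rpow_of_exponent_le h𝓛1 (show (1.1 : ℝ) ≤ 2 by norm_num)
      simpa using this
    calc Real.exp (𝓛 ^ (1.1 : ℝ)) ≤ Real.exp (𝓛 ^ 2) := Real.exp_le_exp.2 h11
      _ < Real.exp (Real.log Y') := Real.exp_lt_exp.2 (by linarith)
      _ = Y' := Real.exp_log hY'0
  have hx₀Y' : x₀ ≤ Y' := by
    calc x₀ ≤ 𝓛 := hLx₀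
      _ ≤ Real.exp 𝓛 := hexp𝓛
      _ ≤ Real.exp (200 * 𝓛) := Real.exp_le_exp.2 (by linarith)
      _ ≤ Y' := hY'exp
  have hlog1 : Real.log Y - Real.log Y' ≤ 1 := by rw [hlogY']; linarith
  have hlogh : Real.log Y - Real.log Y' = (𝓛 ^ 50)⁻¹ := by rw [hlogY', hhdef]; ring
  -- the window geometry: `Y ≤ 2Y′`, `Y′ + Y′^{1/4} ≤ Y`
  have hY2 : Y ≤ 2 * Y' := by
    rw [hYeq, mul_comm]
    refine mul_le_mul_of_nonneg_right ?_ hY'0.le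
    have hlog2 := Real.log_two_gt_d9
    calc Real.exp h ≤ Real.exp (Real.log 2) := Real.exp_le_exp.2 (by linarith)
      _ = 2 := Real.exp_log (by norm_num)
  have hYY'4 : Y' + Y' ^ (1 / 4 : ℝ) ≤ Y := by
    set u : ℝ := Y' ^ (1 / 4 : ℝ) with hudef
    have hu0 : 0 < u := Real.rpow_pos_of_pos hY'0 _
    have hu4 : u ^ 4 = Y' := by
      rw [hudef, ← Real.rpow_natCast, ← Real.rpow_mul hY'0.le]; norm_num
    have hu1 : 1 ≤ u := Real.one_le_rpow hY'1 (by norm_num)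
    have hubig : 𝓛 ^ 50 ≤ u := by
      have h1 : u = Real.exp (Real.log Y' * (1 / 4)) := by
        rw [hudef, Real.rpow_def_of_pos hY'0]
      have h2 : 𝓛 ^ 50 ≤ Real.exp 𝓛 ^ 50 := pow_le_pow_left₀ h𝓛0.le hexp𝓛 50
      have h3 : Real.exp 𝓛 ^ 50 = Real.exp (50 * 𝓛) := by rw [← Real.exp_nat_mul]; norm_num
      rw [h1]
      refine h2.trans ?_
      rw [h3]
      exact Real.exp_le_exp.2 (by linarith)
    have huh : 1 ≤ u * h := by
      rw [hhdef]
      have : 𝓛 ^ 50 * (𝓛 ^ 50)⁻¹ = 1 := mul_inv_cancel₀ (by positivity)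
      calc (1 : ℝ) = 𝓛 ^ 50 * (𝓛 ^ 50)⁻¹ := this.symm
        _ ≤ u * (𝓛 ^ 50)⁻¹ := mul_le_mul_of_nonneg_right hubig (by positivity)
    have hstep : u ≤ Y' * h := by
      calc u = u * 1 * 1 * 1 := by ring
        _ ≤ u * u * u * (u * h) := by gcongr
        _ = u ^ 4 * h := by ring
        _ = Y' * h := by rw [hu4]
    have hexp1 : h + 1 ≤ Real.exp h := Real.add_one_le_exp h
    calc Y' + u ≤ Y' + Y' * h := by linarith
      _ = Y' * (h + 1) := by ring
      _ ≤ Y' * Real.exp h := mul_le_mul_of_nonneg_left hexp1 hY'0.le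
      _ = Y := hYeq.symm
  -- the core estimate (μ = 6)
  have hcore := logfree_core_pow15 χ c' hχ1 hp h𝓛3 h15 j 6 hd0 hr0 (y := Y) (y' := Y') hTY' hY'Y.le
    hlog1 U (ρ := ρ) (η := η) (MU := MU) (BL := 2 * (4 + 3 * 𝓛)) (Minv := 3 * Cinv * 𝓛)
    (C₈₃ := C) (K := K₈) (ℓ₀ := ℓ₀) hUd hU1 hMU0 hU hC0 hU3' hαη hη40 (by positivity) hBL
    (by positivity) hpk hρ1 hρη hρα hLρ hL'ρ hℓ₀0 hℓ' le_rfl hK₈L hE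
  set hatPi : ℝ := ∏ q ∈ (d * r).primeFactors, (1 - (q : ℝ)⁻¹)⁻¹ with hhatPi
  have hPi : 1 ≤ hatPi :=
    Literature.NumberTheory.Sieve.GreenTao2008.GYCorr.one_le_prod_one_sub_inv_inv (d * r)
  have hbook := rhs_logfree_le (𝓛 := 𝓛) (Ly := Real.log Y) (Ly' := Real.log Y')
    (h := Real.log Y - Real.log Y') (c := c) (Cinv := Cinv) (C := C) (K := K₈) (A₁ := A₁)
    (hatPi := hatPi) (MU := MU) (α := alpha D) (η := η) (T := (D : ℝ)) (BL := 2 * (4 + 3 * 𝓛))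
    (Minv := 3 * Cinv * 𝓛) (m := m) h𝓛3 hc hc4 hCinv hC0 hK₈1 hA₁0 hMU0 hMUle hPi hlogY0 hlogY2
    hlogY'1 hαeq rfl hDexp rfl rfl hlogh
  have hlhpos : 0 < Real.log Y - Real.log Y' := by rw [hlogh]; positivity
  have hmain : ‖(∑ n ∈ Finset.Ioc 0 ⌊Y⌋₊,
          (χ (n : ZMod D) * xiZero c' D j n d r * (n : ℂ) ^ (betaMu D 6 - 1)) *
            (Real.log (Y / n) : ℂ)) -
        ∑ n ∈ Finset.Ioc 0 ⌊Y'⌋₊,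
          (χ (n : ZMod D) * xiZero c' D j n d r * (n : ℂ) ^ (betaMu D 6 - 1)) *
            (Real.log (Y' / n) : ℂ)‖ / (Real.log Y - Real.log Y') ≤
      Cbook * (𝓛 ^ 4)⁻¹ * hatPi ^ 4 := by
    refine (div_le_div_of_nonneg_right hcore hlhpos.le).trans ?_
    rw [hCbook]
    exact hbook
  -- the window
  have hwin' := hwin c' D χ j 6 d r Y Y' hx₀Y' hYY'4 hY2
  have hquot : (Y - Y') / Y' ≤ 2 * h := by
    have e : (Y - Y') / Y' = Real.exp h - 1 := by
      rw [hYeq]; field_simp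
    rw [e]
    have habs := Real.abs_exp_sub_one_le (x := h) (by rw [abs_of_pos hh0]; linarith)
    rw [abs_of_pos hh0] at habs
    exact le_trans (le_abs_self _) habs
  have hwin2 : ∑ n ∈ Finset.Ioc ⌊Y'⌋₊ ⌊Y⌋₊,
      ‖χ (n : ZMod D) * xiZero c' D j n d r * (n : ℂ) ^ (betaMu D 6 - 1)‖ ≤
      2 * Cw * (𝓛 ^ 4)⁻¹ * hatPi ^ 4 := by
    refine hwin'.trans ?_
    have h36 : Real.log Y' ^ 4 ≤ (𝓛 ^ 9) ^ 4 := pow_le_pow_left₀ hlogY'0 hlogY'le 4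
    have hPi4 : 1 ≤ hatPi ^ 4 := one_le_pow₀ hPi
    calc Cw * ((Y - Y') / Y') * Real.log Y' ^ 4 ≤ Cw * (2 * h) * (𝓛 ^ 9) ^ 4 := by
          gcongr
      _ = 2 * Cw * ((𝓛 ^ 4)⁻¹ * (𝓛 ^ 10)⁻¹) := by rw [hhdef]; field_simp
      _ ≤ 2 * Cw * ((𝓛 ^ 4)⁻¹ * 1) := by
          gcongr
          exact inv_le_one_of_one_le₀ (one_le_pow₀ h𝓛1)
      _ = 2 * Cw * (𝓛 ^ 4)⁻¹ * 1 := by ring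
      _ ≤ 2 * Cw * (𝓛 ^ 4)⁻¹ * hatPi ^ 4 := by gcongr
  -- the sharp sum from the two Riesz means
  have hR := norm_sum_Ico_le_of_riesz
    (fun n : ℕ => χ (n : ZMod D) * xiZero c' D j n d r * (n : ℂ) ^ (betaMu D 6 - 1)) hY'1 hY'Y
  beta_reduce at hR
  -- the summand of LF is the coefficient `f`
  have hβ6 : betaMu D 6 = beta6 D := by simp [betaMu]
  have hsumeq : (∑ l ∈ Finset.Ico 1 ⌈Y⌉₊,
      χ (l : ZMod D) * xiZero c' D j l d r / (l : ℂ) ^ (1 - beta6 D)) =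
      ∑ l ∈ Finset.Ico 1 ⌈Y⌉₊,
        χ (l : ZMod D) * xiZero c' D j l d r * (l : ℂ) ^ (betaMu D 6 - 1) := by
    refine Finset.sum_congr rfl fun l _ => ?_
    rw [div_eq_mul_inv, ← Complex.cpow_neg, neg_sub, hβ6]
  rw [hsumeq]
  -- assemble
  have hfinal : ‖∑ l ∈ Finset.Ico 1 ⌈Y⌉₊,
      χ (l : ZMod D) * xiZero c' D j l d r * (l : ℂ) ^ (betaMu D 6 - 1)‖ ≤
      (Cbook + 4 * Cw) * (𝓛 ^ 4)⁻¹ * hatPi ^ 4 := by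
    refine hR.trans ?_
    have := add_le_add hmain (mul_le_mul_of_nonneg_left hwin2 (by norm_num : (0 : ℝ) ≤ 2))
    refine this.trans (le_of_eq ?_)
    ring
  refine hfinal.trans (le_of_eq ?_)
  rw [hhatPi, prodInv_eq_self_div_totient₇ hdr0, hℓ]

end Literature.NumberTheory.LFunctions.Zhang2022.Lemma84

end
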